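import Summits.BirchSwinnertonDyer.Rank1Residual.F1Sign2.BUnitChartTamagawaLawsAtTwo
import HarnessLib

/-!
# Cell `bsd-f1-sign2`, DESC-§23 riders 9–12: EXTENSION ROWS of the `b`-unit-chart Tamagawa laws — (TC♭) both halves, (TC♭⁺) master law, (TC♯) odd charts, (TC₁₂₈) the chart-(1,1) cell (-desc g15, MEMO-desc §23-add3 riders 9–12; CANDIDATES-delta DESC v23.11–v23.15)

TYPER FILING (cell `bsd-f1-sign2`, seat `-ty` g11; -desc g15 asks D-desc-51 (15:51:15Z) / D-desc-53 (16:09:38Z, 16:10:56Z «file Ext2 verbatim as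
`F1Sign2/BUnitChartTamagawaLawsAtTwoExt.lean` iff REF1 certifies §23 rider 12 (D-desc-54); otherwise Ext») — REF1 §124 CERTIFIED riders 9, 10, 11 (B), 12 and
CLEARED the gate: «file `Ext2_fixed.lean` b674fd342799abb9 (= `MEMO-desc-data/g15/lean/SketchG15BUnitExt2.lean` c2803af5ace084aa with l.65–66 `intro … δ hδ` /
`intro v hv` merged into one `intro`; rc 0 · 0 err · 0 warn · 0 sorry) verbatim as `F1Sign2/BUnitChartTamagawaLawsAtTwoExt.lean`: (TC♭), (TC♭⁺), (TC♯),
(TC₁₂₈) all plain `def`, 4 glue theorems»): the body of `HOME/REF1-data/b124/Ext2_fixed.lean` b674fd342799abb9 VERBATIM — same flat namespace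
`…Rank1Residual.F1Sign2`, one import (the in-tree sibling `F1Sign2.BUnitChartTamagawaLawsAtTwo`, p644988: carriers `HasBUnitChartOfDepthAtTwo`,
`HasDeepBUnitChartAtTwo`, rows (TC♭-deep) `DeepBUnitChartTamagawaLawAtTwo`, (TC♭-two) `BUnitChartTamagawaTwoLawAtTwo`).  Decls (9): rows (TC♭)
`BUnitChartTamagawaLawAtTwo` (rider 9), (TC♭⁺) `BUnitChartTamagawaMasterLawAtTwo` (rider 10), carrier `HasOddChartAtTwo W s` (+ `HasOddChartAtTwo.mono`),
(TC♯) `OddChartTamagawaLawAtTwo` (rider 11), (TC₁₂₈) `Chart128TamagawaLawAtTwo` (rider 12) — ALL PLAIN support `def`s («PROVED IN WORDS, REF1 §124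
certified», like riders 7/8 in the sibling), no `@[conjecture]`; glue `deepBUnitChartTamagawaLawAtTwo_of_bUnitChart`, `bUnitChartTamagawaTwoLawAtTwo_of_bUnitChart`,
`bUnitChartTamagawaLawAtTwo_of_master` PROVED (kernel).  Typer edits = this header and the REF1, REF2 sentences; the sketch's own module docstring
follows verbatim.  Nothing is asserted: `def … : Prop` rows + kernel-checked glue only; no instance, no notation.
REF1-AUDIT §124 (refuter-bsd-f1-sign2-ref1 g11, 2026-08-28T16:28:48Z; `REF1-AUDIT-v1.md` l.2431; evidence `HOME/REF1-data/b124/` — Probe124.lean,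
e124.py 28bf6760d4f0b59d (pure python, exact arithmetic in ℤ[β_k]), kit j312376; D-desc-47 + D-desc-50 + D-desc-54 ANSWERED): «(TC♭)
`BUnitChartTamagawaLawAtTwo` SURVIVES — theorem-grade in words (riders 7, 8(A) [§120], 9 certified); (TC♭⁺) `BUnitChartTamagawaMasterLawAtTwo`
SURVIVES — theorem-grade in words (rider 10 certified: the μ₀ = 0 cell via v_K(θ₀ − 1) = e/2 — certified twice, structurally θ₀ − 1 =
(i − 1)(ζ − i)/(ζ − 1) in K(ζ) and numerically — and the parity step v(θ² + 5) = 2); glue kernel-checked; RIDER 9 (D ∈ −K^{×2}, λ ≥ 2): Hensel at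
the cyclotomic unit θ₀ = δ/(2s) = cot(π/2^{k+2}), θ₀² + 1 = δ/s² of valuation 2e − 1, v(G(θ₀)) ≥ 2e + 1 > 2e = 2·v(G′(θ₀)) ✓; RIDER 11 (B) (TC♯,
s ≥ 2, k ≥ 2), the five asked points certified: chart scaling x = δ^{e/2}X, y = δ^{3e/4}Y (3e/4 ∈ ℕ ⇔ k ≥ 2), B ∈ b₁K^{×2}, the s = 2 identity
−D_K ∈ (b₁ − 2a″²)K^{×2}, (√2, −1)_{L_k} = (−1)^{e/2}, minimality of y² = x(x² + Aδx + Bδ²) at k ≥ 3 (Tate Step 7) — incl. minimality; RIDER 12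
(TC₁₂₈) checklist (H)(3) certified (criterion for the s = 1 K-model, digit lemma κ₀ ≡ 1 + β^{e/4} + … + β^{e/2} (mod 2, β^{e/2+2}) from the EXACT
identity cot(π/2^{k+2}) − 1 = Σ_{j≤k} β₁⋯β_j, Hensel reduction to 𝔽₂[β]/(β^{e/2+2}), u = 1: c = 4 for k ≥ 3, u = 5: c = 2, k = 2 reversed);
ENGINES independent of -desc's a26–a33 agree at every tested layer; KILLED none.  Gate: file Ext2_fixed b674fd342799abb9 verbatim — (TC♭), (TC♭⁺),
(TC♯), (TC₁₂₈) all plain `def`, 4 glue theorems; no statement edits requested; Chart128's «minimality at k ≥ 3» audit point now reads «settled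
(Tate Step 7, REF1 §124)».»
REF2-PLACEMENT v34 §5.2 (refuter-bsd-f1-sign2-ref2 g34, 2026-08-28T16:00:32Z; `HOME/REF2-PLACEMENT-v34.md` ec7e1b815cf3c567): «riders 9/10 (TC♭, TC♭₀): as
riders 7/8 — STATEMENT NOT IN PRINT (the Dokchitser–Dokchitser 2015 Table 1 open cell; no table over L_k), METHOD KNOWN (Tate Step 7, Hensel + Hilbert
symbol) ⇒ COMPUTABLE-FROM-PRINT, VARIANT; beyond-print NO; now doubly proved in words (-desc Hensel unit; -imc MEMO-imc §10.86 Cor. 5); rider 11 (TC♯,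
odd charts) likewise VARIANT.»  REF2 v35 §3 (refuter-bsd-f1-sign2-ref2 g35, 2026-08-28T16:23:44Z; `HOME/REF2-PLACEMENT-v35.md` 2c54b4d948616f7a): «rider
12 (TC₁₂₈) — COMPUTABLE-FROM-PRINT / VARIANT, statement not located in print (galaxy «Tamagawa number|factor» × title∋twist: 0 rows; Delbourgo 2008 =
theme pointer only), beyond-print no.»
[cite: SilvermanATAEC1994, IV.9.4 Step 7] [cite: DokchitserDokchitser2011, Thm. 5]
PARTITION: none moved (frontier tier); beyond-print theorem: no (explicit Tate/Hensel computations, three-engine census; REF2 COMPUTABLE-FROM-PRINT /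
VARIANT).  BSD is not proved by any of this.
bears_on: F1Sign2 leaf (IMC-LTS `LocalTowerSignLawAtTwo` ⟸ (T_n) ⟸ (TY)(b) Tamagawa clause of `DeepTwistNeronTypeLawAtTwo`; with (TC♭⁺)/(TC♯)/(TC₁₂₈)
the deep-twist Tamagawa law holds in words for EVERY ℚ-curve with a rational 2-torsion point at every layer of its window — residual of the Tamagawa
clause = class (a) `W(ℚ₂)[2] = 0` only; -imc (R)/S3 on the b-unit chart COLLAPSED); asks D-desc-47/50/54 (REF1, answered §124), D-desc-48/51/53 (-ty:
sibling p644988 + this file), D-desc-52 (-data, 248-curve k = 3 job).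

## The sketch's own summary (verbatim)

# Cell `bsd-f1-sign2`, lens `-desc` g15 (MEMO-desc §23-add3 riders 9–11): EXTENSION ROWS of the `b`-unit-chart Tamagawa laws
(sibling of the in-tree `F1Sign2/BUnitChartTamagawaLawsAtTwo.lean`, whose carriers `HasBUnitChartOfDepthAtTwo`,
`HasDeepBUnitChartAtTwo` and rows (TC♭-deep) `DeepBUnitChartTamagawaLawAtTwo`, (TC♭-two) `BUnitChartTamagawaTwoLawAtTwo` it imports).

NEW ROWS.  (TC♭) `BUnitChartTamagawaLawAtTwo` — both halves for `2^k·μ ≥ 4` (rider 9: Hensel at `θ₀ = cot(π/2^{k+2})`);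
(TC♭⁺) `BUnitChartTamagawaMasterLawAtTwo` — every depth from layer `k = 2` on, depth `≥ 2` at `k = 1` (rider 10: the `μ₀ = 0` cell
via `v_K(θ₀ − 1) = e/2` and the parity step `v(θ² + 5) = 2`); glue (TC♭⁺) ⟹ (TC♭) ⟹ (TC♭-deep) ∧ (TC♭-two), all PROVED;
(TC♯) `OddChartTamagawaLawAtTwo` — the odd charts `(s,1)`, `s ≥ 2`, from layer `2` on (rider 11: over `L_k` the odd chart is a
`b`-unit chart with `B ∈ (b/2)K^{×2}`; new inputs `(√2, −1)_{L_k} = (−1)^{e/2}` and, at `s = 2`, `−D_K ∈ (b/2 − 2(a/4)²)K^{×2}`),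
PROVED IN WORDS modulo the minimality audit of the twisted chart model at `k ≥ 3` (census-verified at `k = 2`); and the last
`2`-torsion cell (TC₁₂₈) `Chart128TamagawaLawAtTwo` (chart `(1,1)`, `f₂ = 7`, law from layer `3` on) — PROVED IN WORDS, §23 rider 12.
Census = BC5 witness: kit j309889 `tw4-all.out` 51c8cac051524caa × `an23/a27.py` 97a344bf915eed22 (1 814/1 814 cells `λ ≥ 2`;
`k = 2`: 1 723/1 723 `b`-unit-chart curves) and × `an23/a28.py` (odd charts at `k = 2`: `s = 2`: 165/165, `s ≥ 3`: 133/133;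
`s = 1`: 0/248 — excluded); kit j309612/j309696 `tw2-all.out` (odd charts at the two deepest layers: 42/42 each).
PARTITION: none moved; beyond-print theorem: no (explicit Tate/Hensel computations; REF2: COMPUTABLE FROM PRINT / VARIANT).
Nothing is asserted: `def … : Prop` rows + kernel-checked glue only.
-/

noncomputable section

open scoped Classical NumberField

open WeierstrassCurve Literature.NumberTheory.EllipticCurves Literature.NumberTheory.DiophantineGeometry
open Literature.NumberTheory.EllipticCurves.Rank1Residual ZpExtension IsDedekindDomain NumberField

namespace Summit.BirchSwinnertonDyer.Rank1Residual.F1Sign2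

/-- **(TC♭) THE `b`-UNIT-CHART TAMAGAWA LAW, both halves, shallow charts included** — PROVED IN WORDS (MEMO-desc §23-add3
riders 7, 8(A), 9): for `W/ℚ` elliptic with a `b`-unit chart of depth `μ` at `2` and `k ≥ 1` with `2^k·μ ≥ 4`
(`λ := 2^{k−1}μ ≥ 2`): `c_v(W ⊗ η_{k+1}) = 3 + (Δ_W, 2)₂` for every step generator — NO deepness / additivity hypothesis.
Proof by the class of `D = (a/2)² − b` in `K = ℚ₂(ζ_{2^{k+2}})⁺`: `D ∈ K^{×2}` ⇒ `c = 4` (T2Φ (iii)); `D ∈ 5K^{×2}` ⇒ `c = 2`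
(T2Φ (iv)); `D ∈ −5K^{×2}` ⇒ `c = 2` (rider 8(A): `χ₋₁` has conductor `𝔭²`); `D ∈ −K^{×2}` ⇒ `c = 4` (rider 9: HENSEL at
the cyclotomic unit `θ₀ = cot(π/2^{k+2}) = δ/(2 sin(2π/2^{k+2}))`, `θ₀² + 1 = δ/s²` of valuation `2e − 1`:
`G(θ) = (dθ − a/2)(θ² + 1) − δ/s²` has `v(G(θ₀)) = v(dθ₀ − a/2 − 1) + 2e − 1 ≥ 2e + 1 > 2e = 2·v(G′(θ₀))`, so a unit root
`θ` exists and `x = δ(dθ − a/2)` is the abscissa of a `K`-point of `W^δ` off `T⁰ ∪ (T₀ + T⁰)`).  Census (kit j309889 ×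
a27.py 97a344bf915eed22): `λ ≥ 2`: 1 814/1 814 cells (`k = 1`: 841, `k = 2`: 973), any `f₂`; the cells with `λ ≤ 1` are
`μ₀ = 0` (`f₂ ∈ {5,6}`, 750 curves: law 355/750 at `k = 1` (not deep), 750/750 at `k = 2` (deep)) and `(k, μ₀) = (1, 1)`
(`f₂ = 7`, 132 curves, law 70/132, not deep) — so inside the TOWER window `f₂ ≤ 2k + 2` the only cell of (TY)(b) on this
chart not covered by (TC♭) is `μ₀ = 0 ∧ k ≥ 2`. -/
def BUnitChartTamagawaLawAtTwo : Prop :=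
  ∀ (W : WeierstrassCurve ℚ) [W.IsElliptic] (μ : ℕ), HasBUnitChartOfDepthAtTwo W μ →
    ∀ (κ : ZpExtension ℚ 2), κ.IsCyclotomic → ∀ k : ℕ, 1 ≤ k → 4 ≤ 2 ^ k * μ →
      ∀ δ : ↥(κ.layer k), IsTowerStepGenerator κ k δ →
        haveI : FiniteDimensional ℚ ↥(κ.layer k) := κ.finiteDimensional_layer_holds k
        haveI : NumberField ↥(κ.layer k) := NumberField.of_module_finite ℚ ↥(κ.layer k)
        ∀ v : HeightOneSpectrum (𝓞 ↥(κ.layer k)), (2 : 𝓞 ↥(κ.layer k)) ∈ v.asIdeal →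
          ((deepTwist W κ k δ).tamagawaNumberAt v : ℤ) = 3 + discHilbertSymbolTwo W

/-- Glue (kernel-checked): (TC♭) ⟹ (TC♭-deep) (`μ = 4`, `2^k·4 ≥ 4`). -/
theorem deepBUnitChartTamagawaLawAtTwo_of_bUnitChart (h : BUnitChartTamagawaLawAtTwo) :
    DeepBUnitChartTamagawaLawAtTwo := by
  intro W _ hW κ hκ k hk δ hδ
  have h4 : 4 ≤ 2 ^ k * 4 := by
    have : 1 ≤ 2 ^ k := Nat.one_le_two_pow
    omega
  exact h W 4 hW κ hκ k hk h4 δ hδ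

/-- Glue (kernel-checked): (TC♭) ⟹ (TC♭-two) (`(Δ_W,2)₂ = −1` ⇒ `3 + (−1) = 2`). -/
theorem bUnitChartTamagawaTwoLawAtTwo_of_bUnitChart (h : BUnitChartTamagawaLawAtTwo) :
    BUnitChartTamagawaTwoLawAtTwo := by
  intro W _ μ hW hhs κ hκ k hk hkμ δ hδ v hv
  have := h W μ hW κ hκ k hk hkμ δ hδ v hv
  rw [hhs] at this
  omega

/-- **(TC♭⁺) MASTER ROW: the `b`-unit-chart Tamagawa law from layer `k = 2` on for EVERY depth, and at `k = 1` for depth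
`≥ 2`** — PROVED IN WORDS (MEMO-desc §23-add3 riders 7–10).  Rider 10 adds the cell `μ₀ = 0` (`4 ∣ a₀`, `D` odd) at `k ≥ 2`:
`D ≡ 7 (8)`: Hensel at `θ₀` again, now using `v_K(θ₀ − 1) = e/2 ≥ 2` (`N_{K/ℚ₂}(θ₀ − 1) = ±2^{e/2}`); `D ≡ 3 (8)`: a solution
`θ` would need `(θ, −1)_K = −1`, hence `v(θ − 1) = 1`, hence `v(θ² + 5) = v((θ−1)(θ+1) + 6) = 2` (as `e ≥ 4 > 2`) — even,
contradiction.  So for `k ≥ 2` NO hypothesis on `W` beyond the chart is needed; at `k = 1` the cells `μ₀ ∈ {0,1}` genuinely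
fail (395/750, 62/132 on kit j309889) and contain no curve with `f₂ ≤ 4`.  Census: `k = 2`: 1 723/1 723 `b`-unit-chart curves;
`k = 1`, `μ₀ ≥ 2`: 841/841. -/
def BUnitChartTamagawaMasterLawAtTwo : Prop :=
  ∀ (W : WeierstrassCurve ℚ) [W.IsElliptic] (μ : ℕ), HasBUnitChartOfDepthAtTwo W μ →
    ∀ (κ : ZpExtension ℚ 2), κ.IsCyclotomic → ∀ k : ℕ, 1 ≤ k → (2 ≤ k ∨ 2 ≤ μ) →
      ∀ δ : ↥(κ.layer k), IsTowerStepGenerator κ k δ →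
        haveI : FiniteDimensional ℚ ↥(κ.layer k) := κ.finiteDimensional_layer_holds k
        haveI : NumberField ↥(κ.layer k) := NumberField.of_module_finite ℚ ↥(κ.layer k)
        ∀ v : HeightOneSpectrum (𝓞 ↥(κ.layer k)), (2 : 𝓞 ↥(κ.layer k)) ∈ v.asIdeal →
          ((deepTwist W κ k δ).tamagawaNumberAt v : ℤ) = 3 + discHilbertSymbolTwo W

/-- Glue (kernel-checked): the master row implies (TC♭) (`1 ≤ k ∧ 4 ≤ 2^k·μ ⟹ 2 ≤ k ∨ 2 ≤ μ`). -/
theorem bUnitChartTamagawaLawAtTwo_of_master (h : BUnitChartTamagawaMasterLawAtTwo) :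
    BUnitChartTamagawaLawAtTwo := by
  intro W _ μ hW κ hκ k hk hkμ δ hδ
  refine h W μ hW κ hκ k hk ?_ δ hδ
  rcases Nat.lt_or_ge k 2 with hk2 | hk2
  · right
    have hk1 : k = 1 := by omega
    subst hk1
    omega
  · left; exact hk2

/-- `W/ℚ` has an ODD `2`-torsion chart `(s, 1)` at `2`: a `ℚ₂`-model `y² = x(x² + a x + b)` with `v₂(b) = 1` and
`v₂(a) ≥ s` (the reduced both-in-`𝔭` charts with `t` odd are `(s,1)` and their `2`-twists `(s+1,3)`; `f₂ = 8` when `s ≥ 2`,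
`f₂ = 7` when `s = 1`, census kit j309889). -/
def HasOddChartAtTwo (W : WeierstrassCurve ℚ) (s : ℕ) : Prop :=
  ∃ (C : VariableChange ℚ_[2]) (a b : ℚ_[2]),
    C • (W.baseChange ℚ_[2]) = (⟨0, a, 0, b, 0⟩ : WeierstrassCurve ℚ_[2]) ∧
      ‖b‖ = (2 : ℝ)⁻¹ ∧ ‖a‖ ≤ (2 : ℝ)⁻¹ ^ s

/-- **(TC♯) ODD-CHART Tamagawa law from layer 2 on** — PROVED IN WORDS for `s ≥ 2` (MEMO-desc §23-add3 rider 11): for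
`W/ℚ` with an odd chart `(s,1)`, `s ≥ 2`, and `k ≥ 2`: `c_v(W ⊗ η_{k+1}) = 3 + (Δ_W, 2)₂`.  Over `K = L_k` the chart becomes
the `b`-unit chart `A = a/δ^{e/2}`, `B = b/δ^e ∈ (b/2)·K^{×2}` (as `√2/δ^{e/2} ∈ K`); with `a′ = A/2 ∈ 𝔭^{e(s − 3/2)}` the
four-class argument of riders 8–10 runs verbatim, the new inputs being `(√2, −1)_{L_k} = (−1)^{e/2} = +1` for `k ≥ 2` (so
`d₀ ≡ 1 (mod 𝔭²)` in the Hensel seed and in the symbol step) and, for `s = 2`, the identity `−D_K ∈ (b/2 − 2(a/4)²)K^{×2}`,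
`b/2 − 2(a/4)² ≡ b/2 − 2 (mod 8)` — which is exactly why the law's symbol reads `(b/2 − 2, 2)₂` there.  Census (kit
j309889 × a28.py, `k = 2`): `s = 2`: 165/165, `s ≥ 3`: 133/133; the excluded `s = 1` cell (`f₂ = 7`) FAILS 248/248 at
`k = 2` and obeys the law at the two deeper layers computed (kit j309612/j309696, 42/42 each).  Why it might fail: the
`s = 2` class identity and the `(√2,−1)` step are the points to audit (REF1) — REF1 §124 RIDER 11 (B): all five points (chart scaling, `B ∈ b₁K^{×2}`,
the `s = 2` identity, `(√2, −1)_{L_k} = (−1)^{e/2}`, minimality at `k ≥ 3`) CERTIFIED; REF2 v34 §5.2: VARIANT / COMPUTABLE-FROM-PRINT, beyond-print no. -/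
def OddChartTamagawaLawAtTwo : Prop :=
  ∀ (W : WeierstrassCurve ℚ) [W.IsElliptic] (s : ℕ), 2 ≤ s → HasOddChartAtTwo W s →
    ∀ (κ : ZpExtension ℚ 2), κ.IsCyclotomic → ∀ k : ℕ, 2 ≤ k →
      ∀ δ : ↥(κ.layer k), IsTowerStepGenerator κ k δ →
        haveI : FiniteDimensional ℚ ↥(κ.layer k) := κ.finiteDimensional_layer_holds k
        haveI : NumberField ↥(κ.layer k) := NumberField.of_module_finite ℚ ↥(κ.layer k)
        ∀ v : HeightOneSpectrum (𝓞 ↥(κ.layer k)), (2 : 𝓞 ↥(κ.layer k)) ∈ v.asIdeal →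
          ((deepTwist W κ k δ).tamagawaNumberAt v : ℤ) = 3 + discHilbertSymbolTwo W

/-- **(TC₁₂₈) the LAST 2-torsion cell — PROVED IN WORDS (MEMO-desc §23 rider 12)**: odd chart `(1,1)`
(`v₂(a) = v₂(b) = 1`, `f₂ = 7`, the `128`-type curves) obeys the law from layer `k = 3` on, and obeys the REVERSED
law `c = 3 − (Δ_W,2)₂` at `k = 2` (248/248 cells of kit j309889).  Proof in words: the exact identity
`cot(π/2^{k+2}) − 1 = Σ_{j≤k} β₁⋯β_j` (`β_i = 2cos(π/2^{i+1})`) gives the digit expansion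
`(cot(π/2^{k+2}) − 1)/β^{e/2} ≡ 1 + β^{e/4} + ⋯ + β^{e/2−1} + β^{e/2} (mod 2, β^{e/2+2})`; Hensel (`v(G′) = 3e/2`)
reduces `c = 4` to a square condition in `𝔽₂[β]/(β^{e/2+2})`, solved by `t = β^{e/2−2}` when `(Δ_W,2)₂ = +1`, and
refuted by the parity of `v(η² + √2a₁η + b₁)` when `(Δ_W,2)₂ = −1`.  Census: 42/42 at the layers `n = 4, 5` of kit
j309612/j309696; engines a29–a33 of MEMO-desc-data/g15.  Audit points (REF1, D-desc-50/54): the rider-6 component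
criterion on the `s = 1` model and its minimality at `k ≥ 3` — both settled (Tate Step 7, REF1 §124 rider 12 checklist (H)(3) CERTIFIED; filed as a
PLAIN support `def` per D-desc-53/54); REF2 v35 §3: COMPUTABLE-FROM-PRINT / VARIANT, statement not located in print, beyond-print no. -/
def Chart128TamagawaLawAtTwo : Prop :=
  ∀ (W : WeierstrassCurve ℚ) [W.IsElliptic], HasOddChartAtTwo W 1 → ¬ HasOddChartAtTwo W 2 →
    ∀ (κ : ZpExtension ℚ 2), κ.IsCyclotomic → ∀ k : ℕ, 3 ≤ k →
      ∀ δ : ↥(κ.layer k), IsTowerStepGenerator κ k δ →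
        haveI : FiniteDimensional ℚ ↥(κ.layer k) := κ.finiteDimensional_layer_holds k
        haveI : NumberField ↥(κ.layer k) := NumberField.of_module_finite ℚ ↥(κ.layer k)
        ∀ v : HeightOneSpectrum (𝓞 ↥(κ.layer k)), (2 : 𝓞 ↥(κ.layer k)) ∈ v.asIdeal →
          ((deepTwist W κ k δ).tamagawaNumberAt v : ℤ) = 3 + discHilbertSymbolTwo W

/-- Glue (kernel-checked): odd charts are monotone in `s`. -/
theorem HasOddChartAtTwo.mono {W : WeierstrassCurve ℚ} {s r : ℕ} (h : HasOddChartAtTwo W s) (hrs : r ≤ s) :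
    HasOddChartAtTwo W r := by
  obtain ⟨C, a, b, hC, hb, ha⟩ := h
  exact ⟨C, a, b, hC, hb, ha.trans (pow_le_pow_of_le_one (by norm_num) (by norm_num) hrs)⟩

end Summit.BirchSwinnertonDyer.Rank1Residual.F1Sign2

end
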